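import Mathlib
import Literature.NumberTheory.DiophantineGeometry.GelfondLemma

/-!
# `DivisionGap.PerMultiplesHard` (stmt-ValiantsHypothesis-5068), line `uncharged-face-walk`:
stub `stub_columnRunsArith` — the column large-deviation arithmetic

For `D₁ ≥ 1` and all `a ≥ 128 D₁⁴`: if `a ≤ D₁ d` and `d ≤ a`, then
`4a · Σ_{w' < w} C(a, w') · C(a + 1 − (d − w'), d − w') ≤ C(a, d)` with `w := ⌊a / (64 D₁⁴)⌋`
(all in `ℕ`, truncated subtraction and floor division as written).

Proof (elementary, entirely in `ℕ`).  Fix `w' < w`, put `k := d − w'` (so `d = k + w'`),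
`t := ⌊k/2⌋`, `m := k − 1 − t`, `q := ⌊m / (2 D₁)⌋`.  Four inequalities:
* Vandermonde: `C(a − t, k) · C(t, w') ≤ C(a, k + w')` (one term of `Nat.add_choose_eq`; the
  tree's `Literature.NumberTheory.DiophantineGeometry.choose_mul_choose_le_choose_add`);
* top deficit: `C(n, k) · (n + m)^m ≤ C(n + m, k) · (n + m − k)^m` (iterate
  `Nat.choose_mul_succ_eq`), used with `n := a + 1 − k`, `n + m = a − t`;
* bottom ratio: `C(a, j) · (t + 1 − j)^j ≤ C(t, j) · a^j` (the `Nat.descFactorial` sandwich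
  `(t + 1 − j)^j ≤ j! C(t, j)`, `j! C(a, j) ≤ a^j`);
* Bernoulli gain: `x ≤ r y`, `1 ≤ r`, `r q ≤ m` give `2^q · x^m ≤ (x + y)^m`, used with
  `x := a − t − k`, `y := k`, `r := 2 D₁`.
Multiplying, `4 a w · C(a, w') · C(a + 1 − k, k) · P ≤ C(a, d) · P` for the positive
`P := (a − t)^m (t + 1 − w')^{w'}` as soon as `4 a w (4 D₁)^{w'} ≤ 2^q`; the bookkeeping
`k ≥ 63 D₁³ w`, `a ≤ 4 D₁ (t + 1 − w')`, `q + 1 ≥ 15 D₁² w`, `a < 128 D₁⁴ w`, `w ≥ 2` reduces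
this to `2^{9 + 4 D₁ + 2w + (D₁ + 2) w} ≤ 2^q` (`n < 2^n`).  Summing the `w` per-term bounds
`4 a w · (term) ≤ C(a, d)` over `w' < w` and cancelling `w` gives the claim. [folklore]
-/

noncomputable section

set_option linter.dupNamespace false

namespace Summit.ValiantsHypothesis.ValiantsHypothesis.Theorems.DivisionGap.PerMultiplesHard.ColumnRunsArith

open Finset
open scoped BigOperators

/-- One step of the top-argument recursion:
`C(n, k) · (n + 1 + j) ≤ C(n + 1, k) · (n + 1 + j − k)`. -/
theorem choose_mul_le_step (n k j : ℕ) :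
    n.choose k * (n + 1 + j) ≤ (n + 1).choose k * (n + 1 + j - k) := by
  rcases Nat.lt_or_ge (n + 1) k with h | h
  · rw [Nat.choose_eq_zero_of_lt (Nat.lt_of_succ_lt h), zero_mul]
    exact Nat.zero_le _
  · have h1 : n.choose k * (n + 1) = (n + 1).choose k * (n + 1 - k) :=
      Nat.choose_mul_succ_eq n k
    have h2 : n.choose k ≤ (n + 1).choose k := Nat.choose_le_succ n k
    have h3 : n + 1 + j - k = (n + 1 - k) + j := by omega
    rw [h3, mul_add, h1, mul_add]
    exact Nat.add_le_add_left (Nat.mul_le_mul_right j h2) _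

/-- Top deficit: `C(n, k) · (n + m)^m ≤ C(n + m, k) · (n + m − k)^m`
(raising the top argument of a binomial coefficient by `m` gains the factor
`((n + m)/(n + m − k))^m`). -/
theorem choose_mul_pow_le (k : ℕ) : ∀ m n : ℕ,
    n.choose k * (n + m) ^ m ≤ (n + m).choose k * (n + m - k) ^ m := by
  intro m
  induction m with
  | zero => intro n; simp
  | succ m ih =>
    intro n
    have e : n + (m + 1) = n + 1 + m := by omega
    rw [e]
    calc n.choose k * (n + 1 + m) ^ (m + 1)
        = n.choose k * (n + 1 + m) * (n + 1 + m) ^ m := by ring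
      _ ≤ (n + 1).choose k * (n + 1 + m - k) * (n + 1 + m) ^ m :=
          Nat.mul_le_mul_right _ (choose_mul_le_step n k m)
      _ = (n + 1 + m - k) * ((n + 1).choose k * (n + 1 + m) ^ m) := by ring
      _ ≤ (n + 1 + m - k) * ((n + 1 + m).choose k * (n + 1 + m - k) ^ m) :=
          Nat.mul_le_mul_left _ (ih (n + 1))
      _ = (n + 1 + m).choose k * (n + 1 + m - k) ^ (m + 1) := by ring

/-- Bottom ratio: `C(a, j) · (t + 1 − j)^j ≤ C(t, j) · a^j`. -/
theorem choose_mul_pow_sub_le (a t j : ℕ) :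
    a.choose j * (t + 1 - j) ^ j ≤ t.choose j * a ^ j := by
  have h1 : a.descFactorial j ≤ a ^ j := Nat.descFactorial_le_pow a j
  have h2 : (t + 1 - j) ^ j ≤ t.descFactorial j := Nat.pow_sub_le_descFactorial t j
  rw [Nat.descFactorial_eq_factorial_mul_choose] at h1 h2
  refine Nat.le_of_mul_le_mul_left ?_ (Nat.factorial_pos j)
  calc j.factorial * (a.choose j * (t + 1 - j) ^ j)
      = (j.factorial * a.choose j) * (t + 1 - j) ^ j := by ring
    _ ≤ a ^ j * (j.factorial * t.choose j) := Nat.mul_le_mul h1 h2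
    _ = j.factorial * (t.choose j * a ^ j) := by ring

/-- Bernoulli, the first two terms of the binomial expansion:
`x^{r+1} + (r + 1) x^r y ≤ (x + y)^{r+1}`. -/
theorem pow_add_mul_le (x y : ℕ) : ∀ r : ℕ,
    x ^ (r + 1) + (r + 1) * x ^ r * y ≤ (x + y) ^ (r + 1) := by
  intro r
  induction r with
  | zero => simp
  | succ r ih =>
    calc x ^ (r + 1 + 1) + (r + 1 + 1) * x ^ (r + 1) * y
        ≤ x ^ (r + 1 + 1) + (r + 1 + 1) * x ^ (r + 1) * y + (r + 1) * x ^ r * y * y :=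
          Nat.le_add_right _ _
      _ = (x ^ (r + 1) + (r + 1) * x ^ r * y) * (x + y) := by ring
      _ ≤ (x + y) ^ (r + 1) * (x + y) := Nat.mul_le_mul_right _ ih
      _ = (x + y) ^ (r + 1 + 1) := by ring

/-- Doubling: if `1 ≤ r` and `x ≤ r y` then `2 x^r ≤ (x + y)^r`. -/
theorem two_mul_pow_le (x y r : ℕ) (hr : 1 ≤ r) (hx : x ≤ r * y) :
    2 * x ^ r ≤ (x + y) ^ r := by
  obtain ⟨s, rfl⟩ : ∃ s, r = s + 1 := ⟨r - 1, by omega⟩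
  calc 2 * x ^ (s + 1) = x ^ (s + 1) + x * x ^ s := by ring
    _ ≤ x ^ (s + 1) + (s + 1) * y * x ^ s :=
        Nat.add_le_add_left (Nat.mul_le_mul_right _ hx) _
    _ = x ^ (s + 1) + (s + 1) * x ^ s * y := by ring
    _ ≤ (x + y) ^ (s + 1) := pow_add_mul_le x y s

/-- Bernoulli gain: `1 ≤ r`, `x ≤ r y`, `r q ≤ m` give `2^q · x^m ≤ (x + y)^m`. -/
theorem two_pow_mul_pow_le (x y r q m : ℕ) (hr : 1 ≤ r) (hx : x ≤ r * y) (hm : r * q ≤ m) :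
    2 ^ q * x ^ m ≤ (x + y) ^ m := by
  have h1 : (2 * x ^ r) ^ q ≤ ((x + y) ^ r) ^ q :=
    Nat.pow_le_pow_left (two_mul_pow_le x y r hr hx) q
  have h2 : x ^ (m - r * q) ≤ (x + y) ^ (m - r * q) :=
    Nat.pow_le_pow_left (Nat.le_add_right x y) _
  calc 2 ^ q * x ^ m = (2 * x ^ r) ^ q * x ^ (m - r * q) := by
        rw [mul_pow, ← pow_mul, mul_assoc, ← pow_add, Nat.add_sub_cancel' hm]
    _ ≤ ((x + y) ^ r) ^ q * (x + y) ^ (m - r * q) := Nat.mul_le_mul h1 h2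
    _ = (x + y) ^ m := by rw [← pow_mul, ← pow_add, Nat.add_sub_cancel' hm]

/-- Final numeric step: `4 a w (4 D)^{w'} ≤ 2^q` once `w ≥ 2`, `w' < w`, `a < 128 D⁴ w` and
`q + 1 ≥ 15 D² w` (everything is absorbed by `n < 2^n`). -/
theorem numeric_bound (D a w w' q : ℕ) (hD : 1 ≤ D) (hw : 2 ≤ w) (hw' : w' < w)
    (ha : a < 128 * (D ^ 4 * w)) (hq : 15 * (D ^ 2 * w) ≤ q + 1) :
    4 * a * w * (4 * D) ^ w' ≤ 2 ^ q := by
  have hD2 : D < 2 ^ D := Nat.lt_two_pow_self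
  have hw2 : w < 2 ^ w := Nat.lt_two_pow_self
  have h4D : 4 * D ≤ 2 ^ (D + 2) :=
    calc 4 * D ≤ 4 * 2 ^ D := by omega
      _ = 2 ^ (D + 2) := by ring
  have h1 : (4 * D) ^ w' ≤ 2 ^ ((D + 2) * w) :=
    calc (4 * D) ^ w' ≤ (2 ^ (D + 2)) ^ w' := Nat.pow_le_pow_left h4D w'
      _ = 2 ^ ((D + 2) * w') := by rw [← pow_mul]
      _ ≤ 2 ^ ((D + 2) * w) :=
          Nat.pow_le_pow_right (by norm_num) (Nat.mul_le_mul_left _ hw'.le)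
  have hD4 : D ^ 4 ≤ 2 ^ (4 * D) :=
    calc D ^ 4 ≤ (2 ^ D) ^ 4 := Nat.pow_le_pow_left hD2.le 4
      _ = 2 ^ (4 * D) := by rw [← pow_mul, Nat.mul_comm]
  have h2 : 4 * a * w ≤ 2 ^ (9 + 4 * D + 2 * w) := by
    have h3 : a ≤ 128 * (2 ^ (4 * D) * 2 ^ w) :=
      calc a ≤ 128 * (D ^ 4 * w) := ha.le
        _ ≤ 128 * (2 ^ (4 * D) * 2 ^ w) := Nat.mul_le_mul_left _ (Nat.mul_le_mul hD4 hw2.le)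
    calc 4 * a * w ≤ 4 * (128 * (2 ^ (4 * D) * 2 ^ w)) * 2 ^ w :=
          Nat.mul_le_mul (Nat.mul_le_mul_left _ h3) hw2.le
      _ = 2 ^ (9 + 4 * D + 2 * w) := by ring
  have hDw : 2 * D ≤ D * w :=
    calc 2 * D = D * 2 := by ring
      _ ≤ D * w := Nat.mul_le_mul_left D hw
  have hwD : w ≤ D * w := Nat.le_mul_of_pos_left w hD
  have hY : D * w ≤ D ^ 2 * w :=
    calc D * w ≤ D * (D * w) := Nat.le_mul_of_pos_left _ hD
      _ = D ^ 2 * w := by ring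
  have hexp : 9 + 4 * D + 2 * w + (D + 2) * w ≤ q := by
    have e : (D + 2) * w = D * w + 2 * w := by ring
    rw [e]
    omega
  calc 4 * a * w * (4 * D) ^ w' ≤ 2 ^ (9 + 4 * D + 2 * w) * 2 ^ ((D + 2) * w) :=
        Nat.mul_le_mul h2 h1
    _ = 2 ^ (9 + 4 * D + 2 * w + (D + 2) * w) := by rw [← pow_add]
    _ ≤ 2 ^ q := Nat.pow_le_pow_right (by norm_num) hexp

/-- Per-term bound: for `D ≥ 1`, `w ≥ 2`, `64 D⁴ w ≤ a < 64 D⁴ (w + 1)`, `a ≤ D d`, `d ≤ a` and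
`w' < w`: `4 a w · C(a, w') · C(a + 1 − (d − w'), d − w') ≤ C(a, d)`. -/
theorem per_term (D a d w w' : ℕ) (hD : 1 ≤ D) (hw : 2 ≤ w) (hKw : 64 * D ^ 4 * w ≤ a)
    (haK : a < 64 * D ^ 4 * (w + 1)) (had : a ≤ D * d) (hda : d ≤ a) (hw' : w' < w) :
    4 * a * w * (a.choose w' * (a + 1 - (d - w')).choose (d - w')) ≤ a.choose d := by
  -- units: `X := D⁴ w`, `64 X ≤ a < 128 X`
  have hX : 64 * (D ^ 4 * w) ≤ a := by rw [← Nat.mul_assoc]; exact hKw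
  have hD4w : D ^ 4 ≤ D ^ 4 * w := Nat.le_mul_of_pos_right _ (by omega)
  have ha128 : a < 128 * (D ^ 4 * w) := by
    have e : 64 * D ^ 4 * (w + 1) = 64 * (D ^ 4 * w) + 64 * D ^ 4 := by ring
    rw [e] at haK
    omega
  have hD4 : D ≤ D ^ 4 := Nat.le_self_pow (by norm_num) D
  have hDw4 : D * w ≤ D ^ 4 * w := Nat.mul_le_mul_right w hD4
  have hwD : w ≤ D * w := Nat.le_mul_of_pos_left w hD
  have hDw' : D * w' ≤ D * w := Nat.mul_le_mul_left D hw'.le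
  -- `w' < d`, so `d = k + w'`
  have hdw' : w' < d := by
    refine Nat.lt_of_mul_lt_mul_left (a := D) ?_
    show D * w' < D * d
    omega
  obtain ⟨k, rfl⟩ : ∃ k, d = k + w' := ⟨d - w', by omega⟩
  rw [Nat.add_sub_cancel]
  have e1 : D * (k + w') = D * k + D * w' := by ring
  rw [e1] at had
  -- `k ≥ 63 D³ w`
  have hw3 : w ≤ D ^ 3 * w := Nat.le_mul_of_pos_left w (by positivity)
  have hk63 : 63 * (D ^ 3 * w) ≤ k := by
    refine Nat.le_of_mul_le_mul_left (c := D) ?_ hD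
    have e2 : D * (63 * (D ^ 3 * w)) = 63 * (D ^ 4 * w) := by ring
    rw [e2]
    omega
  -- the trivial case `2k > a + 1`
  rcases Nat.lt_or_ge (a + 1 - k) k with hsmall | hbig
  · rw [Nat.choose_eq_zero_of_lt hsmall]
    simp
  -- `t := ⌊k/2⌋`, `m := k − 1 − t`, `q := ⌊m/(2D)⌋`
  obtain ⟨t, ht⟩ : ∃ t, t = k / 2 := ⟨_, rfl⟩
  obtain ⟨m, hm⟩ : ∃ m, m = k - 1 - t := ⟨_, rfl⟩
  obtain ⟨q, hq⟩ : ∃ q, q = m / (2 * D) := ⟨_, rfl⟩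
  have htw' : w' ≤ t := by omega
  have htk : t + 1 ≤ k := by omega
  have hkat : k ≤ a - t := by omega
  have hta : t ≤ a := by omega
  have h2D : 0 < 2 * D := by omega
  have hq1 : 2 * D * q ≤ m := by
    rw [hq, Nat.mul_comm]
    exact Nat.div_mul_le_self m (2 * D)
  have hq2 : m < 2 * D * (q + 1) := by
    rw [hq]
    exact Nat.lt_mul_div_succ m h2D
  -- `q + 1 ≥ 15 D² w`
  have hq15 : 15 * (D ^ 2 * w) ≤ q + 1 := by
    refine Nat.le_of_mul_le_mul_left (c := 4 * D) ?_ (by omega)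
    have e3 : 4 * D * (15 * (D ^ 2 * w)) = 60 * (D ^ 3 * w) := by ring
    have e4 : 4 * D * (q + 1) = 2 * (2 * D * (q + 1)) := by ring
    rw [e3, e4]
    omega
  -- `a ≤ 4 D (t + 1 − w')`
  have hDt : D * k ≤ 2 * (D * t) + D :=
    calc D * k ≤ D * (2 * t + 1) := Nat.mul_le_mul_left D (by omega)
      _ = 2 * (D * t) + D := by ring
  have e5 : D * (t + 1 - w') + D * w' = D * t + D := by
    have e : t + 1 - w' + w' = t + 1 := by omega
    calc D * (t + 1 - w') + D * w' = D * (t + 1 - w' + w') := by rw [mul_add]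
      _ = D * t + D := by rw [e, mul_add, mul_one]
  have haT : a ≤ 4 * D * (t + 1 - w') := by
    have e6 : 4 * D * (t + 1 - w') = 4 * (D * (t + 1 - w')) := by ring
    rw [e6]
    omega
  -- `x := a − t − k ≤ 2 D k`
  have hDk : D * w' ≤ D * k := Nat.mul_le_mul_left D (by omega)
  have hx : a - t - k ≤ 2 * D * k := by
    have e8 : 2 * D * k = 2 * (D * k) := by ring
    rw [e8]
    omega
  -- the four inequalities
  have A1 : (a + 1 - k).choose k * (a - t) ^ m ≤ (a - t).choose k * (a - t - k) ^ m := by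
    have h := choose_mul_pow_le k m (a + 1 - k)
    have e7 : a + 1 - k + m = a - t := by omega
    rw [e7] at h
    exact h
  have A2 : a.choose w' * (t + 1 - w') ^ w' ≤ t.choose w' * a ^ w' :=
    choose_mul_pow_sub_le a t w'
  have A3 : (a - t).choose k * t.choose w' ≤ a.choose (k + w') := by
    have h := Literature.NumberTheory.DiophantineGeometry.choose_mul_choose_le_choose_add
      (a - t) t k w'
    rw [Nat.sub_add_cancel hta] at h
    exact h
  have A4 : 4 * a * w * (4 * D) ^ w' ≤ 2 ^ q := numeric_bound D a w w' q hD hw hw' ha128 hq15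
  have A5 : 2 ^ q * (a - t - k) ^ m ≤ (a - t) ^ m := by
    have h := two_pow_mul_pow_le (a - t - k) k (2 * D) q m (by omega) hx hq1
    rw [Nat.sub_add_cancel hkat] at h
    exact h
  -- multiply by the positive `P := (a − t)^m (t + 1 − w')^{w'}` and chain
  have hP : 0 < (a - t) ^ m * (t + 1 - w') ^ w' :=
    Nat.mul_pos (pow_pos (by omega) m) (pow_pos (by omega) w')
  refine Nat.le_of_mul_le_mul_right ?_ hP
  calc 4 * a * w * (a.choose w' * (a + 1 - k).choose k) * ((a - t) ^ m * (t + 1 - w') ^ w')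
      = 4 * a * w * (((a + 1 - k).choose k * (a - t) ^ m) *
          (a.choose w' * (t + 1 - w') ^ w')) := by ring
    _ ≤ 4 * a * w * (((a - t).choose k * (a - t - k) ^ m) * (t.choose w' * a ^ w')) :=
        Nat.mul_le_mul_left _ (Nat.mul_le_mul A1 A2)
    _ = ((a - t).choose k * t.choose w') * (4 * a * w * a ^ w') * (a - t - k) ^ m := by ring
    _ ≤ a.choose (k + w') * (4 * a * w * (4 * D * (t + 1 - w')) ^ w') * (a - t - k) ^ m :=
        Nat.mul_le_mul_right _ (Nat.mul_le_mul A3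
          (Nat.mul_le_mul_left _ (Nat.pow_le_pow_left haT w')))
    _ = a.choose (k + w') * (4 * a * w * (4 * D) ^ w') *
          ((t + 1 - w') ^ w' * (a - t - k) ^ m) := by ring
    _ ≤ a.choose (k + w') * 2 ^ q * ((t + 1 - w') ^ w' * (a - t - k) ^ m) :=
        Nat.mul_le_mul_right _ (Nat.mul_le_mul_left _ A4)
    _ = a.choose (k + w') * (t + 1 - w') ^ w' * (2 ^ q * (a - t - k) ^ m) := by ring
    _ ≤ a.choose (k + w') * (t + 1 - w') ^ w' * (a - t) ^ m := Nat.mul_le_mul_left _ A5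
    _ = a.choose (k + w') * ((a - t) ^ m * (t + 1 - w') ^ w') := by ring

/-- **Registered stub `stub_columnRunsArith` — the column large-deviation arithmetic.**
For `D₁ ≥ 1` there is `a₀` (namely `128 D₁⁴`) such that for all `a ≥ a₀` and all `d` with
`a ≤ D₁ d`, `d ≤ a`:
`4 a · Σ_{w' < a/(64 D₁⁴)} C(a, w') · C(a + 1 − (d − w'), d − w') ≤ C(a, d)`.
Proof: sum the per-term bounds `per_term` over the `w := a/(64 D₁⁴) ≥ 2` values of `w'` and
cancel `w`. [folklore] -/
theorem stub_columnRunsArith :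
    ∀ D₁ : ℕ, 1 ≤ D₁ → ∃ a₀ : ℕ, ∀ a ≥ a₀, ∀ d : ℕ, a ≤ D₁ * d → d ≤ a →
      4 * a * (∑ w' ∈ Finset.range (a / (64 * D₁ ^ 4)), a.choose w' * (a + 1 - (d - w')).choose (d - w')) ≤
        a.choose d := by
  intro D hD
  refine ⟨128 * D ^ 4, fun a ha d had hda => ?_⟩
  have hK : 0 < 64 * D ^ 4 := by positivity
  set w := a / (64 * D ^ 4) with hw_def
  have hw : 2 ≤ w := by
    rw [hw_def, Nat.le_div_iff_mul_le hK]
    omega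
  have hKw : 64 * D ^ 4 * w ≤ a := by
    rw [hw_def]
    exact Nat.mul_div_le a (64 * D ^ 4)
  have haK : a < 64 * D ^ 4 * (w + 1) := by
    rw [hw_def]
    exact Nat.lt_mul_div_succ a hK
  have hwpos : 0 < w := by omega
  refine Nat.le_of_mul_le_mul_left (c := w) ?_ hwpos
  calc w * (4 * a * ∑ w' ∈ range w, a.choose w' * (a + 1 - (d - w')).choose (d - w'))
      = ∑ w' ∈ range w, 4 * a * w * (a.choose w' * (a + 1 - (d - w')).choose (d - w')) := by
        rw [Finset.mul_sum, Finset.mul_sum]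
        exact Finset.sum_congr rfl fun x _ => by ring
    _ ≤ ∑ _w' ∈ range w, a.choose d :=
        Finset.sum_le_sum fun x hx =>
          per_term D a d w x hD hw hKw haK had hda (Finset.mem_range.1 hx)
    _ = w * a.choose d := by rw [Finset.sum_const, Finset.card_range, smul_eq_mul]

end Summit.ValiantsHypothesis.ValiantsHypothesis.Theorems.DivisionGap.PerMultiplesHard.ColumnRunsArith

end
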